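import Summits.NavierStokesRegularity.NavierStokesRegularity.Theorems.ExtremiserTransienceNearExtremalTransienceExtremiserLiouvilleConstantSpeedSlideEnstrophy
import Summits.NavierStokesRegularity.NavierStokesRegularity.Theorems.ExtremiserTransienceNearExtremalTransienceExtremiserLiouvilleConstantSpeedSlideTail
import HarnessLib

/-!
# Crux `ExtremiserTransience.NearExtremalTransience` (stmt-NavierStokesRegularity-21883), line `extremiser_liouville`,
# stub K1b — THE ENSTROPHY LAW OF THE PIOLA SLIDE (integrated form of identity (A))

`--supports stmt-NavierStokesRegularity-21883` (helper).  Author: prover seat `ns-el-k1b` (g8).  Record: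
`Cruxes/NearExtremalTransience/Lines/extremiser_liouville_k1b_slide.md` §2.  Continues `…ConstantSpeedSlideEnstrophy` (pointwise
form) and `…ConstantSpeedSlideGenerator` (axial integration-by-parts rule).

For `V ∈ C²` and the slide generator `φ_g = g(x₂)∂₂V + g′(x₂)V_h` the enstrophy variation is
```
  a₁(φ_g) = ∫⟪ω, curl φ_g⟫ = −½∫g′(x₂)‖ω‖² + ∫g′(x₂)·( 2|∂₂V_h|² − 2⟪∇_hV₂,∂₂V_h⟫ + ω₂² ) + ∫g″(x₂)·( ⟪V_h,∂₂V_h⟫ − ⟪V_h,∇_hV₂⟫ )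
```
(`integral_inner_curl_slideGenerator_eq`): integrate `inner_curl_slideGenerator`, rewrite `curl ∂₂V = ∂₂ω` (`curl_fderiv_apply_comm`)
and use the axial rule `∫g⟪ω,∂₂ω⟫ = −½∫g′‖ω‖²` (`integral_axialWeight_inner_fderiv_curl_eq`).  Since
`‖ω‖² = |∇_hV₂|² + |∂₂V_h|² − 2⟪∇_hV₂,∂₂V_h⟫ + ω₂²`, the `g′`-part is `∫g′[(3/2)|∂₂V_h|² + ½ω₂² − ½|∇_hV₂|² − ⟪∇_hV₂,∂₂V_h⟫]`
(`integral_inner_curl_slideGenerator_eq'`) — COERCIVE in the vertical shear and the axial vorticity, up to the `V₂`-small term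
`|∇_hV₂|²` (`|∇_hV₂| ≤ (‖V‖/M)|∇_hV|` for the constant-speed residue) and the `g″`-boundary pairing, which two further integrations
by parts turn into `−½∫g‴(‖V‖² − 2V₂²)` and the jet's energy-flux invariance into `V₂`-small terms (record (KIN); next files).
The integrability of the two weighted quadratic densities is first taken as hypotheses (`integral_inner_curl_slideGenerator_eq`,
`…_eq'`) and then discharged from `DV ∈ L²`, `ω, ∂₂ω ∈ L²`, slab integrability of `‖V‖²` and bounded, slab-supported `g″, g‴`
(`slideEnstrophyLaw`: the law with the boundary pairing already converted by `…SlideTail.integral_slideTail_eq`,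
`a₁(φ_g) = ∫g′[(3/2)|∂₂V_h|² + ½ω₂² − ½|∇_hV₂|² − ⟪∇_hV₂,∂₂V_h⟫] − ½∫g‴(‖V‖² − 2V₂²)`).

WHAT THIS IS NOT: K1b is NOT proved; nothing here proves NS regularity. [folklore]
-/

noncomputable section

open Set Filter Topology MeasureTheory Metric Function InnerProductSpace
open scoped ENNReal NNReal Topology InnerProductSpace RealInnerProductSpace ContDiff
open Literature.Analysis.FluidPDE Literature.Analysis

namespace Summit.NavierStokesRegularity.NavierStokesRegularity.Theorems

-- the problem directory repeats the summit name (`NavierStokesRegularity/NavierStokesRegularity`)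
set_option linter.dupNamespace false

namespace ExtremiserLiouville

open DepletionLadder.KStar

variable {V : EuclideanSpace ℝ (Fin 3) → EuclideanSpace ℝ (Fin 3)} {g : ℝ → ℝ}

/-- **The enstrophy law of the Piola slide** (integrated identity (A) of the record, curl form): for `V ∈ C²` with
`ω = curl V ∈ L²`, `‖ω‖‖∂₂ω‖ ∈ L¹`, `g ∈ C²` with `g, g′` bounded, and the two weighted quadratic densities integrable,
`∫⟪ω, curl(g(x₂)∂₂V + g′(x₂)V_h)⟫ = −½∫g′‖ω‖² + ∫g′(2|∂₂V_h|² − 2⟪∇_hV₂,∂₂V_h⟫ + ω₂²) + ∫g″(⟪V_h,∂₂V_h⟫ − ⟪V_h,∇_hV₂⟫)`.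
[folklore] -/
theorem integral_inner_curl_slideGenerator_eq (hV : ContDiff ℝ 2 V) (hg : ContDiff ℝ 2 g) {K : ℝ}
    (hgK : ∀ s, |g s| ≤ K) (hg'K : ∀ s, |deriv g s| ≤ K)
    (hZ : Integrable (fun x => ‖curl V x‖ ^ 2) volume)
    (hZD : Integrable (fun x => ‖curl V x‖ * ‖fderiv ℝ (curl V) x (EuclideanSpace.single (2 : Fin 3) (1 : ℝ))‖) volume)
    (hB : Integrable (fun x => deriv g (x 2) *
      (2 * (fderiv ℝ V x (EuclideanSpace.single 2 1) 0 ^ 2 + fderiv ℝ V x (EuclideanSpace.single 2 1) 1 ^ 2) -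
        2 * (fderiv ℝ V x (EuclideanSpace.single 0 1) 2 * fderiv ℝ V x (EuclideanSpace.single 2 1) 0 +
          fderiv ℝ V x (EuclideanSpace.single 1 1) 2 * fderiv ℝ V x (EuclideanSpace.single 2 1) 1) +
        curl V x 2 ^ 2)) volume)
    (hC : Integrable (fun x => deriv (deriv g) (x 2) *
      ((V x 0 * fderiv ℝ V x (EuclideanSpace.single 2 1) 0 + V x 1 * fderiv ℝ V x (EuclideanSpace.single 2 1) 1) -
        (V x 0 * fderiv ℝ V x (EuclideanSpace.single 0 1) 2 + V x 1 * fderiv ℝ V x (EuclideanSpace.single 1 1) 2))) volume) :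
    (∫ x, ⟪curl V x, curl (fun y : EuclideanSpace ℝ (Fin 3) =>
        g (y 2) • fderiv ℝ V y (EuclideanSpace.single (2 : Fin 3) (1 : ℝ)) +
          deriv g (y 2) • (V y - (V y 2) • EuclideanSpace.single (2 : Fin 3) (1 : ℝ))) x⟫) =
      -(1 / 2) * (∫ x, deriv g (x 2) * ‖curl V x‖ ^ 2) +
        (∫ x, deriv g (x 2) *
          (2 * (fderiv ℝ V x (EuclideanSpace.single 2 1) 0 ^ 2 + fderiv ℝ V x (EuclideanSpace.single 2 1) 1 ^ 2) -
            2 * (fderiv ℝ V x (EuclideanSpace.single 0 1) 2 * fderiv ℝ V x (EuclideanSpace.single 2 1) 0 +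
              fderiv ℝ V x (EuclideanSpace.single 1 1) 2 * fderiv ℝ V x (EuclideanSpace.single 2 1) 1) +
            curl V x 2 ^ 2)) +
        ∫ x, deriv (deriv g) (x 2) *
          ((V x 0 * fderiv ℝ V x (EuclideanSpace.single 2 1) 0 + V x 1 * fderiv ℝ V x (EuclideanSpace.single 2 1) 1) -
            (V x 0 * fderiv ℝ V x (EuclideanSpace.single 0 1) 2 + V x 1 * fderiv ℝ V x (EuclideanSpace.single 1 1) 2)) := by
  set e₂ : EuclideanSpace ℝ (Fin 3) := EuclideanSpace.single (2 : Fin 3) (1 : ℝ) with he₂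
  have hK0 : 0 ≤ K := (abs_nonneg _).trans (hgK 0)
  -- the pointwise identity, with `curl ∂₂V = ∂₂ω`
  have hpt : ∀ x, ⟪curl V x, curl (fun y : EuclideanSpace ℝ (Fin 3) =>
      g (y 2) • fderiv ℝ V y e₂ + deriv g (y 2) • (V y - (V y 2) • e₂)) x⟫ =
      g (x 2) * ⟪curl V x, fderiv ℝ (curl V) x e₂⟫ +
        (deriv g (x 2) *
          (2 * (fderiv ℝ V x e₂ 0 ^ 2 + fderiv ℝ V x e₂ 1 ^ 2) -
            2 * (fderiv ℝ V x (EuclideanSpace.single 0 1) 2 * fderiv ℝ V x e₂ 0 +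
              fderiv ℝ V x (EuclideanSpace.single 1 1) 2 * fderiv ℝ V x e₂ 1) +
            curl V x 2 ^ 2) +
        deriv (deriv g) (x 2) *
          ((V x 0 * fderiv ℝ V x e₂ 0 + V x 1 * fderiv ℝ V x e₂ 1) -
            (V x 0 * fderiv ℝ V x (EuclideanSpace.single 0 1) 2 + V x 1 * fderiv ℝ V x (EuclideanSpace.single 1 1) 2))) := by
    intro x
    rw [inner_curl_slideGenerator hV hg x, curl_fderiv_apply_comm hV x e₂, add_assoc]
  simp_rw [hpt]
  -- integrability of the first term
  have cω : Continuous (curl V) := (contDiff_curl (n := 1) (by exact_mod_cast hV)).continuous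
  have cDω : Continuous fun x => fderiv ℝ (curl V) x e₂ :=
    ((contDiff_curl (n := 1) (by exact_mod_cast hV)).continuous_fderiv one_ne_zero).clm_apply continuous_const
  have cg : Continuous fun x : EuclideanSpace ℝ (Fin 3) => g (x 2) :=
    hg.continuous.comp (PiLp.continuous_apply 2 _ (2 : Fin 3))
  have hA : Integrable (fun x => g (x 2) * ⟪curl V x, fderiv ℝ (curl V) x e₂⟫) volume := by
    refine (hZD.const_mul K).mono' ((cg.mul (cω.inner (𝕜 := ℝ) cDω)).aestronglyMeasurable)
      (Eventually.of_forall fun x => ?_)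
    rw [Real.norm_eq_abs, abs_mul]
    exact mul_le_mul (hgK _) (abs_real_inner_le_norm _ _) (abs_nonneg _) hK0
  have hBC : Integrable (fun x => deriv g (x 2) *
      (2 * (fderiv ℝ V x e₂ 0 ^ 2 + fderiv ℝ V x e₂ 1 ^ 2) -
        2 * (fderiv ℝ V x (EuclideanSpace.single 0 1) 2 * fderiv ℝ V x e₂ 0 +
          fderiv ℝ V x (EuclideanSpace.single 1 1) 2 * fderiv ℝ V x e₂ 1) +
        curl V x 2 ^ 2) +
      deriv (deriv g) (x 2) *
        ((V x 0 * fderiv ℝ V x e₂ 0 + V x 1 * fderiv ℝ V x e₂ 1) -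
          (V x 0 * fderiv ℝ V x (EuclideanSpace.single 0 1) 2 + V x 1 * fderiv ℝ V x (EuclideanSpace.single 1 1) 2))) volume :=
    hB.add hC
  rw [integral_add hA hBC, integral_add hB hC,
    integral_axialWeight_inner_fderiv_curl_eq hV hZ hZD (hg.of_le (by norm_num)) hgK hg'K]
  ring

/-- **Coercive form.**  With `‖ω‖² = |∇_hV₂|² + |∂₂V_h|² − 2⟪∇_hV₂,∂₂V_h⟫ + ω₂²` expanded pointwise the `g′`-part of the law is
`∫g′·[ (3/2)|∂₂V_h|² + ½ω₂² − ½|∇_hV₂|² − ⟪∇_hV₂,∂₂V_h⟫ ]`:  **vertical shear and axial vorticity enter with a definite sign.**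
(Pointwise algebra on the integrand of the previous theorem; same hypotheses.) [folklore] -/
theorem integral_inner_curl_slideGenerator_eq' (hV : ContDiff ℝ 2 V) (hg : ContDiff ℝ 2 g) {K : ℝ}
    (hgK : ∀ s, |g s| ≤ K) (hg'K : ∀ s, |deriv g s| ≤ K)
    (hZ : Integrable (fun x => ‖curl V x‖ ^ 2) volume)
    (hZD : Integrable (fun x => ‖curl V x‖ * ‖fderiv ℝ (curl V) x (EuclideanSpace.single (2 : Fin 3) (1 : ℝ))‖) volume)
    (hB : Integrable (fun x => deriv g (x 2) *
      (2 * (fderiv ℝ V x (EuclideanSpace.single 2 1) 0 ^ 2 + fderiv ℝ V x (EuclideanSpace.single 2 1) 1 ^ 2) -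
        2 * (fderiv ℝ V x (EuclideanSpace.single 0 1) 2 * fderiv ℝ V x (EuclideanSpace.single 2 1) 0 +
          fderiv ℝ V x (EuclideanSpace.single 1 1) 2 * fderiv ℝ V x (EuclideanSpace.single 2 1) 1) +
        curl V x 2 ^ 2)) volume)
    (hC : Integrable (fun x => deriv (deriv g) (x 2) *
      ((V x 0 * fderiv ℝ V x (EuclideanSpace.single 2 1) 0 + V x 1 * fderiv ℝ V x (EuclideanSpace.single 2 1) 1) -
        (V x 0 * fderiv ℝ V x (EuclideanSpace.single 0 1) 2 + V x 1 * fderiv ℝ V x (EuclideanSpace.single 1 1) 2))) volume) :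
    (∫ x, ⟪curl V x, curl (fun y : EuclideanSpace ℝ (Fin 3) =>
        g (y 2) • fderiv ℝ V y (EuclideanSpace.single (2 : Fin 3) (1 : ℝ)) +
          deriv g (y 2) • (V y - (V y 2) • EuclideanSpace.single (2 : Fin 3) (1 : ℝ))) x⟫) =
      (∫ x, deriv g (x 2) *
          ((3 / 2) * (fderiv ℝ V x (EuclideanSpace.single 2 1) 0 ^ 2 + fderiv ℝ V x (EuclideanSpace.single 2 1) 1 ^ 2) +
            (1 / 2) * curl V x 2 ^ 2 -
            (1 / 2) * (fderiv ℝ V x (EuclideanSpace.single 0 1) 2 ^ 2 + fderiv ℝ V x (EuclideanSpace.single 1 1) 2 ^ 2) -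
            (fderiv ℝ V x (EuclideanSpace.single 0 1) 2 * fderiv ℝ V x (EuclideanSpace.single 2 1) 0 +
              fderiv ℝ V x (EuclideanSpace.single 1 1) 2 * fderiv ℝ V x (EuclideanSpace.single 2 1) 1))) +
        ∫ x, deriv (deriv g) (x 2) *
          ((V x 0 * fderiv ℝ V x (EuclideanSpace.single 2 1) 0 + V x 1 * fderiv ℝ V x (EuclideanSpace.single 2 1) 1) -
            (V x 0 * fderiv ℝ V x (EuclideanSpace.single 0 1) 2 + V x 1 * fderiv ℝ V x (EuclideanSpace.single 1 1) 2)) := by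
  rw [integral_inner_curl_slideGenerator_eq hV hg hgK hg'K hZ hZD hB hC]
  have hK0 : 0 ≤ K := (abs_nonneg _).trans (hgK 0)
  -- `‖ω‖²` in coordinates
  have hω : ∀ x, ‖curl V x‖ ^ 2 =
      (fderiv ℝ V x (EuclideanSpace.single 1 1) 2 - fderiv ℝ V x (EuclideanSpace.single 2 1) 1) ^ 2 +
        (fderiv ℝ V x (EuclideanSpace.single 2 1) 0 - fderiv ℝ V x (EuclideanSpace.single 0 1) 2) ^ 2 + curl V x 2 ^ 2 := by
    intro x
    rw [EuclideanSpace.real_norm_sq_eq, Fin.sum_univ_three]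
    have h0 : curl V x 0 = fderiv ℝ V x (EuclideanSpace.single 1 1) 2 - fderiv ℝ V x (EuclideanSpace.single 2 1) 1 := by
      simp [curl]
    have h1 : curl V x 1 = fderiv ℝ V x (EuclideanSpace.single 2 1) 0 - fderiv ℝ V x (EuclideanSpace.single 0 1) 2 := by
      simp [curl]
    rw [h0, h1]
  -- integrability of the weighted enstrophy
  have cg' : Continuous fun x : EuclideanSpace ℝ (Fin 3) => deriv g (x 2) :=
    (hg.continuous_deriv (by norm_num)).comp (PiLp.continuous_apply 2 _ (2 : Fin 3))
  have cω : Continuous (curl V) := (contDiff_curl (n := 1) (by exact_mod_cast hV)).continuous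
  have hW : Integrable (fun x => deriv g (x 2) * ‖curl V x‖ ^ 2) volume := by
    refine (hZ.const_mul K).mono' ((cg'.mul (cω.norm.pow 2)).aestronglyMeasurable) (Eventually.of_forall fun x => ?_)
    rw [Real.norm_eq_abs, abs_mul, abs_of_nonneg (sq_nonneg ‖curl V x‖)]
    exact mul_le_mul_of_nonneg_right (hg'K _) (sq_nonneg _)
  congr 1
  rw [← integral_const_mul, ← integral_add (hW.const_mul _) hB]
  refine integral_congr_ae (Eventually.of_forall fun x => ?_)
  simp only [hω]
  ring

/-! ## The law under natural hypotheses -/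

/-- **THE ENSTROPHY LAW OF THE PIOLA SLIDE** (natural hypotheses).  For a divergence-free `V ∈ C²` with `DV ∈ L²`,
`ω = curl V ∈ L²`, `∂₂ω ∈ L²`, `‖V‖²` integrable on the slab `{|x₂| ≤ T}`, and an axial profile `g ∈ C³` with `|g|,|g′|,|g″|,|g‴| ≤ K`
and `g″, g‴` vanishing for `T ≤ |s|`:
`∫⟪ω, curl(g(x₂)∂₂V + g′(x₂)V_h)⟫ = ∫g′[(3/2)|∂₂V_h|² + ½ω₂² − ½|∇_hV₂|² − ⟪∇_hV₂,∂₂V_h⟫] − ½∫g‴(‖V‖² − 2V₂²)`.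
For the residue jet the last term is `∫g‴V₂²` (energy-flux invariance) and then `2∫g′(∂₂V₂)² + 2∫g′⟪∇_hV₂,∂₂V_h⟫`
(`…SlideKinematics`). [folklore] -/
theorem slideEnstrophyLaw (hV : ContDiff ℝ 2 V) (hdiv : VectorCalculus.IsDivFree V) (hg : ContDiff ℝ 3 g) {K T : ℝ}
    (hgK : ∀ s, |g s| ≤ K) (hg1K : ∀ s, |deriv g s| ≤ K) (hg2K : ∀ s, |deriv (deriv g) s| ≤ K)
    (hg3K : ∀ s, |deriv (deriv (deriv g)) s| ≤ K)
    (hg2T : ∀ s, T ≤ |s| → deriv (deriv g) s = 0) (hg3T : ∀ s, T ≤ |s| → deriv (deriv (deriv g)) s = 0)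
    (hD : Integrable (fun x => ‖fderiv ℝ V x‖ ^ 2) volume)
    (hZ : Integrable (fun x => ‖curl V x‖ ^ 2) volume)
    (hZ2 : Integrable (fun x => ‖fderiv ℝ (curl V) x (EuclideanSpace.single (2 : Fin 3) (1 : ℝ))‖ ^ 2) volume)
    (hslab : Integrable (fun x => {x : EuclideanSpace ℝ (Fin 3) | |x 2| ≤ T}.indicator (fun x => ‖V x‖ ^ 2) x) volume) :
    (∫ x, ⟪curl V x, curl (fun y : EuclideanSpace ℝ (Fin 3) =>
        g (y 2) • fderiv ℝ V y (EuclideanSpace.single (2 : Fin 3) (1 : ℝ)) +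
          deriv g (y 2) • (V y - (V y 2) • EuclideanSpace.single (2 : Fin 3) (1 : ℝ))) x⟫) =
      (∫ x, deriv g (x 2) *
          ((3 / 2) * (fderiv ℝ V x (EuclideanSpace.single 2 1) 0 ^ 2 + fderiv ℝ V x (EuclideanSpace.single 2 1) 1 ^ 2) +
            (1 / 2) * curl V x 2 ^ 2 -
            (1 / 2) * (fderiv ℝ V x (EuclideanSpace.single 0 1) 2 ^ 2 + fderiv ℝ V x (EuclideanSpace.single 1 1) 2 ^ 2) -
            (fderiv ℝ V x (EuclideanSpace.single 0 1) 2 * fderiv ℝ V x (EuclideanSpace.single 2 1) 0 +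
              fderiv ℝ V x (EuclideanSpace.single 1 1) 2 * fderiv ℝ V x (EuclideanSpace.single 2 1) 1))) +
        -(1 / 2) * ∫ x, deriv (deriv (deriv g)) (x 2) * (‖V x‖ ^ 2 - 2 * (V x 2) ^ 2) := by
  have hK0 : 0 ≤ K := (abs_nonneg _).trans (hgK 0)
  have hV1 : ContDiff ℝ 1 V := hV.of_le (by norm_num)
  have hVd : Differentiable ℝ V := hV.differentiable two_ne_zero
  have cV : Continuous V := hV.continuous
  have cDV : Continuous (fderiv ℝ V) := hV.continuous_fderiv two_ne_zero
  have cω : Continuous (curl V) := (contDiff_curl (n := 1) (by exact_mod_cast hV)).continuous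
  have hgd2 : ContDiff ℝ 2 (deriv g) := by
    have h3 : ContDiff ℝ (2 + 1) g := by rw [show ((2 : WithTop ℕ∞) + 1) = 3 by norm_num]; exact hg
    exact h3.deriv'
  have hgd1 : ContDiff ℝ 1 (deriv (deriv g)) := by
    have h2 : ContDiff ℝ (1 + 1) (deriv g) := by rw [show ((1 : WithTop ℕ∞) + 1) = 2 by norm_num]; exact hgd2
    exact h2.deriv'
  have hgc2 : ContDiff ℝ 2 g := hg.of_le (by norm_num)
  have cg1 : Continuous fun x : EuclideanSpace ℝ (Fin 3) => deriv g (x 2) :=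
    hgd2.continuous.comp (PiLp.continuous_apply 2 _ (2 : Fin 3))
  have cg2 : Continuous fun x : EuclideanSpace ℝ (Fin 3) => deriv (deriv g) (x 2) :=
    hgd1.continuous.comp (PiLp.continuous_apply 2 _ (2 : Fin 3))
  -- coordinates are bounded by norms
  have hcoordV : ∀ x (i : Fin 3), |V x i| ≤ ‖V x‖ := fun x i => by
    have := PiLp.norm_apply_le (p := 2) (V x) i; rwa [Real.norm_eq_abs] at this
  have hne : ∀ j : Fin 3, ‖(EuclideanSpace.single j (1 : ℝ) : EuclideanSpace ℝ (Fin 3))‖ = 1 := fun j => by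
    rw [PiLp.norm_single, norm_one]
  have hcoordD : ∀ x (i j : Fin 3), |fderiv ℝ V x (EuclideanSpace.single j 1) i| ≤ ‖fderiv ℝ V x‖ := fun x i j => by
    have h1 := PiLp.norm_apply_le (p := 2) (fderiv ℝ V x (EuclideanSpace.single j 1)) i
    rw [Real.norm_eq_abs] at h1
    refine h1.trans ?_
    calc ‖fderiv ℝ V x (EuclideanSpace.single j 1)‖ ≤ ‖fderiv ℝ V x‖ * ‖(EuclideanSpace.single j (1 : ℝ) : EuclideanSpace ℝ (Fin 3))‖ :=
          (fderiv ℝ V x).le_opNorm _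
      _ = ‖fderiv ℝ V x‖ := by rw [hne, mul_one]
  have hcoordω : ∀ x, |curl V x 2| ≤ ‖curl V x‖ := fun x => by
    have := PiLp.norm_apply_le (p := 2) (curl V x) 2; rwa [Real.norm_eq_abs] at this
  -- `‖ω‖‖∂₂ω‖ ∈ L¹`
  have hZD : Integrable (fun x => ‖curl V x‖ * ‖fderiv ℝ (curl V) x (EuclideanSpace.single (2 : Fin 3) (1 : ℝ))‖) volume := by
    have cDω : Continuous fun x => fderiv ℝ (curl V) x (EuclideanSpace.single (2 : Fin 3) (1 : ℝ)) :=
      ((contDiff_curl (n := 1) (by exact_mod_cast hV)).continuous_fderiv one_ne_zero).clm_apply continuous_const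
    refine ((hZ.add hZ2).div_const 2).mono' (cω.norm.mul cDω.norm).aestronglyMeasurable (Eventually.of_forall fun x => ?_)
    rw [Real.norm_eq_abs, abs_of_nonneg (mul_nonneg (norm_nonneg _) (norm_nonneg _))]
    show _ ≤ (‖curl V x‖ ^ 2 + ‖fderiv ℝ (curl V) x (EuclideanSpace.single (2 : Fin 3) (1 : ℝ))‖ ^ 2) / 2
    nlinarith [sq_nonneg (‖curl V x‖ - ‖fderiv ℝ (curl V) x (EuclideanSpace.single (2 : Fin 3) (1 : ℝ))‖)]
  -- (hB) the `g′`-weighted quadratic density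
  have cc : ∀ i j : Fin 3, Continuous fun x => fderiv ℝ V x (EuclideanSpace.single j 1) i := fun i j =>
    (PiLp.continuous_apply 2 _ i).comp (cDV.clm_apply continuous_const)
  have cω2 : Continuous fun x => curl V x 2 := (PiLp.continuous_apply 2 _ (2 : Fin 3)).comp cω
  have hB : Integrable (fun x => deriv g (x 2) *
      (2 * (fderiv ℝ V x (EuclideanSpace.single 2 1) 0 ^ 2 + fderiv ℝ V x (EuclideanSpace.single 2 1) 1 ^ 2) -
        2 * (fderiv ℝ V x (EuclideanSpace.single 0 1) 2 * fderiv ℝ V x (EuclideanSpace.single 2 1) 0 +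
          fderiv ℝ V x (EuclideanSpace.single 1 1) 2 * fderiv ℝ V x (EuclideanSpace.single 2 1) 1) +
        curl V x 2 ^ 2)) volume := by
    refine (((hD.const_mul 8).add hZ).const_mul K).mono' ?_ (Eventually.of_forall fun x => ?_)
    · exact (cg1.mul ((((((cc 0 2).pow 2).add ((cc 1 2).pow 2)).const_mul 2).sub
        ((((cc 2 0).mul (cc 0 2)).add ((cc 2 1).mul (cc 1 2))).const_mul 2)).add (cω2.pow 2))).aestronglyMeasurable
    rw [Real.norm_eq_abs, abs_mul]
    have a1 := hcoordD x 0 2; have a2 := hcoordD x 1 2; have a3 := hcoordD x 2 0; have a4 := hcoordD x 2 1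
    have a5 := hcoordω x
    rw [abs_le] at a1 a2 a3 a4 a5
    have hq : |2 * (fderiv ℝ V x (EuclideanSpace.single 2 1) 0 ^ 2 + fderiv ℝ V x (EuclideanSpace.single 2 1) 1 ^ 2) -
        2 * (fderiv ℝ V x (EuclideanSpace.single 0 1) 2 * fderiv ℝ V x (EuclideanSpace.single 2 1) 0 +
          fderiv ℝ V x (EuclideanSpace.single 1 1) 2 * fderiv ℝ V x (EuclideanSpace.single 2 1) 1) +
        curl V x 2 ^ 2| ≤ 8 * ‖fderiv ℝ V x‖ ^ 2 + ‖curl V x‖ ^ 2 := by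
      rw [abs_le]; constructor <;> nlinarith [sq_nonneg (fderiv ℝ V x (EuclideanSpace.single 0 1) 2 + fderiv ℝ V x (EuclideanSpace.single 2 1) 0),
        sq_nonneg (fderiv ℝ V x (EuclideanSpace.single 1 1) 2 + fderiv ℝ V x (EuclideanSpace.single 2 1) 1),
        sq_nonneg (fderiv ℝ V x (EuclideanSpace.single 0 1) 2 - fderiv ℝ V x (EuclideanSpace.single 2 1) 0),
        sq_nonneg (fderiv ℝ V x (EuclideanSpace.single 1 1) 2 - fderiv ℝ V x (EuclideanSpace.single 2 1) 1),
        norm_nonneg (fderiv ℝ V x), norm_nonneg (curl V x)]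
    exact mul_le_mul (hg1K _) hq (abs_nonneg _) hK0
  -- (hC) the `g″`-weighted `V·DV` density (supported in the slab)
  set SL : Set (EuclideanSpace ℝ (Fin 3)) := {x | |x 2| ≤ T} with hSL
  have hslab_ind : ∀ x, deriv (deriv g) (x 2) ≠ 0 → SL.indicator (fun x => ‖V x‖ ^ 2) x = ‖V x‖ ^ 2 := by
    intro x hx
    have hxT : |x 2| ≤ T := by by_contra hc; exact hx (hg2T _ (not_le.1 hc).le)
    rw [indicator_of_mem (show x ∈ SL from hxT)]
  have dom : ∀ x (i i' j : Fin 3), |deriv (deriv g) (x 2) * (V x i * fderiv ℝ V x (EuclideanSpace.single j 1) i')| ≤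
      K * (SL.indicator (fun x => ‖V x‖ ^ 2) x + ‖fderiv ℝ V x‖ ^ 2) := by
    intro x i i' j
    by_cases hx : deriv (deriv g) (x 2) = 0
    · rw [hx, zero_mul, abs_zero]; exact mul_nonneg hK0 (add_nonneg (indicator_nonneg (fun _ _ => sq_nonneg _) _) (sq_nonneg _))
    rw [hslab_ind x hx, abs_mul, abs_mul]
    have h1 : |V x i| * |fderiv ℝ V x (EuclideanSpace.single j 1) i'| ≤ ‖V x‖ * ‖fderiv ℝ V x‖ :=
      mul_le_mul (hcoordV x i) (hcoordD x i' j) (abs_nonneg _) (norm_nonneg _)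
    have h2 : ‖V x‖ * ‖fderiv ℝ V x‖ ≤ ‖V x‖ ^ 2 + ‖fderiv ℝ V x‖ ^ 2 := by
      nlinarith [sq_nonneg (‖V x‖ - ‖fderiv ℝ V x‖), norm_nonneg (V x), norm_nonneg (fderiv ℝ V x)]
    calc |deriv (deriv g) (x 2)| * (|V x i| * |fderiv ℝ V x (EuclideanSpace.single j 1) i'|) ≤ K * (‖V x‖ * ‖fderiv ℝ V x‖) :=
          mul_le_mul (hg2K _) h1 (by positivity) hK0
      _ ≤ K * (‖V x‖ ^ 2 + ‖fderiv ℝ V x‖ ^ 2) := mul_le_mul_of_nonneg_left h2 hK0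
  have intVD : ∀ (i i' j : Fin 3),
      Integrable (fun x => deriv (deriv g) (x 2) * (V x i * fderiv ℝ V x (EuclideanSpace.single j 1) i')) volume := by
    intro i i' j
    refine ((hslab.add hD).const_mul K).mono' ?_ (Eventually.of_forall fun x => by rw [Real.norm_eq_abs]; exact dom x i i' j)
    exact (cg2.mul (((PiLp.continuous_apply 2 _ i).comp cV).mul (cc i' j))).aestronglyMeasurable
  have hC : Integrable (fun x => deriv (deriv g) (x 2) *
      ((V x 0 * fderiv ℝ V x (EuclideanSpace.single 2 1) 0 + V x 1 * fderiv ℝ V x (EuclideanSpace.single 2 1) 1) -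
        (V x 0 * fderiv ℝ V x (EuclideanSpace.single 0 1) 2 + V x 1 * fderiv ℝ V x (EuclideanSpace.single 1 1) 2))) volume := by
    have e : (fun x => deriv (deriv g) (x 2) *
        ((V x 0 * fderiv ℝ V x (EuclideanSpace.single 2 1) 0 + V x 1 * fderiv ℝ V x (EuclideanSpace.single 2 1) 1) -
          (V x 0 * fderiv ℝ V x (EuclideanSpace.single 0 1) 2 + V x 1 * fderiv ℝ V x (EuclideanSpace.single 1 1) 2))) =
        fun x => (deriv (deriv g) (x 2) * (V x 0 * fderiv ℝ V x (EuclideanSpace.single 2 1) 0) +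
          deriv (deriv g) (x 2) * (V x 1 * fderiv ℝ V x (EuclideanSpace.single 2 1) 1)) -
          (deriv (deriv g) (x 2) * (V x 0 * fderiv ℝ V x (EuclideanSpace.single 0 1) 2) +
            deriv (deriv g) (x 2) * (V x 1 * fderiv ℝ V x (EuclideanSpace.single 1 1) 2)) := by
      funext x; ring
    rw [e]; exact ((intVD 0 0 2).add (intVD 1 1 2)).sub ((intVD 0 2 0).add (intVD 1 2 1))
  rw [integral_inner_curl_slideGenerator_eq' hV hgc2 hgK hg1K hZ hZD hB hC,
    integral_slideTail_eq hV1 hdiv hgd1 hg2K hg3K hg2T hg3T hD hslab]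

end ExtremiserLiouville

end Summit.NavierStokesRegularity.NavierStokesRegularity.Theorems

end
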